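import Summits.ResolutionOfSingularities.ResolutionOfSingularities.Theorems.EquisingularLiftEquisingularLiftNatProjectiveSpaceLineDirStepUnobs
import Summits.ResolutionOfSingularities.ResolutionOfSingularities.Theorems.EquisingularLiftEquisingularLiftNatNoseHypUnobsOfOneBlowup
import Summits.ResolutionOfSingularities.ResolutionOfSingularities.Theorems.EquisingularLiftEquisingularLiftNatNoseTowerBTriplePrimeSpecimens
import Summits.ResolutionOfSingularities.ResolutionOfSingularities.Theorems.EquisingularLiftEquisingularLiftNatNoseResidueClassTwoRegular
import HarnessLib

/-!
# [OURS · L1 W4.5(b) · EL♮(3) · nose residue, brick N-1 (c)] THE WHITNEY-TYPE CUBIC IS IN ν1 — the first kernel inhabitant of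
# `NoseHypUnobsBTriplePrime` (the 37th registration's hypothesis)

Cell `res-hironaka`, LADDER-RESOLUTION rung L (D-0089), slot W4.5(b), crux chain w45b: child crux **EL♮(3)** =
stmt-ResolutionOfSingularities-20148, parent EL♮ = stmt-…-20038; registered nose residue
`stub_elnat_three_nonisolated_nonUnobsNonPointsFirstNoseBTriplePrime` (38th registration, CHILD v44r), hypothesis `¬ NoseHypUnobsBTriplePrime k n H ι`
((H-ν1), …NatResidueHypDefs5 ✓ p648428, entered at the 37th registration; rung (R-ν1) ✓ p651025). WIDTH seat res-L1-w45b-nose-w1 g2 (D-0157 DOOR 1),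
desk booking **N-1** (STATUS 2026-08-28T18:04:04Z), piece (c) = the assembly over (a) ✓ `…NatNoseHypUnobsOfOneBlowup` and (b) `…NatProjectiveSpaceLine{Splitting,DirStepUnobs}`.
`--supports stmt-ResolutionOfSingularities-20148 --as helper`. OURS; NOT a statement of H. Hironaka's 2017 manuscript (nothing of [Hironaka2017] is
asserted); AI-written, AI review weaker than expert review. DEF-FREE; no `sorry`; standard axioms. HONESTY: EL♮(3) is NOT proved here; resolution of
singularities in positive characteristic is NOT proved here (dimension 3 is Cossart–Piltant 2008/2009 in print); this file only shows that the named
hypothesis ν1 of OUR route is INHABITED in the kernel (so the 37th cut removed a non-empty class from the residue), for the same specimen that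
res-L1-w45b-nose-w3 certified in the B‴ class₂ predicate (✓ p642717 `WhitneyCubic.reachNoseTowerBTriplePrime_whitneyCubic`).

WHAT. `WhitneyCubic.noseHypUnobsBTriplePrime_whitneyCubic (K) [Field K] : NoseHypUnobsBTriplePrime K 3 H ι` for `H = V₊(x₁x₂² − x₀x₃²) ⊂ ℙ³_K`
(res-D-pv-022's R2 specimen, every characteristic), with the nose `Z = Σ = V₊(x₂, x₃)` (the double line): `Σ̃` regular (nose-w4 ✓
`isRegular_redSub_of_isLiftableNoseClass₂` on `SkewLines.line_isLiftableNoseClass`), UNOBSTRUCTED — `DirStepUnobs ℙ³ univ _ Σ` by N-1 (b)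
`P3Line.dirStepUnobs_doubleLine` (the twisted producer D3-7 ✓ p655133 on the two standard charts, `𝒩_{Σ/ℙ³} = 𝒪(1)²`) —, `Σ ⊆ ι(H) ⊄ Σ`, infinite, a
curve (nose-w3 / pv-013 ✓), and ONE blow-up of `𝓘⟨Σ⟩ = ker Proj(f_K)` with regular reduced strict transform (`LinearCentre.isRegular_reducedStrictTransform_of_blowupModel`
over pv-022's `isRegular_of_isBlowup_comap`), fed to the zero-round schema N-1 (a) `noseHypUnobsBTriplePrime_of_oneBlowup`.

References (index only): R. Hartshorne, *Algebraic Geometry* (1977), II §7, III Ex. 4.5 [cite: Hartshorne1977].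
-/

set_option linter.dupNamespace false -- mandated namespace `Summit.<Summit>.<Problem>` of this single-conjunct summit

noncomputable section

open CategoryTheory CategoryTheory.Limits AlgebraicGeometry TopologicalSpace
open MvPolynomial HomogeneousLocalization
open Literature.AlgebraicGeometry.Resolution
open Literature.AlgebraicGeometry.Motives Literature.AlgebraicGeometry.Motives.SmoothHypersurface
open Literature.AlgebraicGeometry.Motives.ProjectiveSpace
open AlgebraicGeometry.Scheme.IdealSheafData

namespace Summit.ResolutionOfSingularities.ResolutionOfSingularities.Cruxes.EquisingularLiftNat.Sections

namespace WhitneyCubic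

variable (K : Type) [Field K]

/-- ★★★ **THE ν1 NOSE PREDICATE HOLDS FOR THE WHITNEY-TYPE CUBIC** `H = V₊(x₁x₂² − x₀x₃²) ⊂ ℙ³_K` (any field `K`, every characteristic):
`NoseHypUnobsBTriplePrime K 3 H ι` with the nose `Z = Σ = V₊(x₂, x₃)` — `Σ̃` regular, `Ȟ¹(Σ̃, 𝒩_{Σ̃/ℙ³}) = 0` (N-1 (b)), `Σ ⊆ ι(H) ⊄ Σ`, infinite, a curve,
ONE blow-up of `𝓘⟨Σ⟩` with regular reduced strict transform, EMPTY B‴ round phase (N-1 (a)). First kernel inhabitant of the 37th registration's hypothesis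
class ν1. [OURS · L1 W4.5b · EL♮(3) · N-1 (c); NOT a statement of the manuscript; EL♮(3) NOT proved] -/
theorem noseHypUnobsBTriplePrime_whitneyCubic :
    NoseHypUnobsBTriplePrime K 3 (hypersurface (form K)).left (hypersurfaceι (form K)).left := by
  classical
  letI := MvPolynomial.gradedAlgebra (σ := Fin (1 + 2 + 1)) (R := K)
  letI := MvPolynomial.gradedAlgebra (σ := Fin (1 + 1)) (R := K)
  obtain ⟨fk, hfk', hfkC, hfkX⟩ := EquisingularLift.StrataSplit.LinearCentre.exists_kill K 1 2
  haveI := isIntegral_hypersurface K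
  haveI : IsLocallyNoetherian (Literature.AlgebraicGeometry.Motives.projectiveSpace (2 + 1) K).left :=
    EquisingularLift.StrataSplit.LinearCentre.isLocallyNoetherian_proj K (1 + 2)
  -- a blow-up of `ℙ³_K` along `Λ = ker Proj(f_K) = 𝓘(Σ)`
  obtain ⟨F₂, υ, hυ⟩ := exists_isBlowup (Proj (homogeneousSubmodule (Fin (1 + 2 + 1)) K)) (Proj.map fk hfk').ker
  have hΛ := ker_projMap_kill_eq_vanishingIdeal_doubleLine K fk hfk' hfkC hfkX (isClosed_doubleLine K)
  have hsupp := support_ker_projMap_kill_eq_doubleLine K fk hfk' hfkC hfkX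
  -- the reduced strict transform is regular
  have hreg : Scheme.IsRegular (vanishingIdeal (⟨closure (υ ⁻¹' (Set.range (hypersurfaceι (form K)).left \
      ((Proj.map fk hfk').ker.support : Set (Proj (homogeneousSubmodule (Fin (1 + 2 + 1)) K))))), isClosed_closure⟩ :
      Closeds F₂)).subscheme :=
    EquisingularLift.StrataSplit.LinearCentre.isRegular_reducedStrictTransform_of_blowupModel (hypersurfaceι (form K)).left
      (Proj.map fk hfk').ker (not_range_subset_support K fk hfk' hfkC hfkX)
      (fun Z ρ hρ => isRegular_of_isBlowup_comap K fk hfk' hfkC hfkX Z ρ hρ) υ hυ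
  rw [hsupp] at hreg
  rw [hΛ] at hυ
  -- `Σ̃` is regular: `Σ` is a line, hence class₂
  have hZreg := isRegular_redSub_of_isLiftableNoseClass₂ K 3
    (IsLiftableNoseClass₂.base _ (SkewLines.line_isLiftableNoseClass K 2 3 0 (by decide) (by decide) (by decide))) (isClosed_doubleLine K)
  exact noseHypUnobsBTriplePrime_of_oneBlowup K 3 _ (hypersurfaceι (form K)).left _ (isClosed_doubleLine K)
    (fun x => hZreg x) (P3Line.dirStepUnobs_doubleLine K)
    (doubleLine_subset_range_ι K) (not_range_ι_subset_doubleLine K) (doubleLine_infinite K) (doubleLine_curve K) F₂ υ hυ hreg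

end WhitneyCubic

end Summit.ResolutionOfSingularities.ResolutionOfSingularities.Cruxes.EquisingularLiftNat.Sections

end
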